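import Literature.Probability.Percolation.SahiSunflowerSeparation
import HarnessLib

/-!
# `NoHeavyLowerTail` (crux stmt-CriticalPhenomena-4575): the three 2|2-SPLIT separation events of four vertices form a
# sunflower with core `Q₄` — cell identities (companion of `Literature…SahiSunflowerSeparation`'s perfect-matching triple)

Support file (certificate seat `prim-cert-2` gen 9; `--supports stmt-CriticalPhenomena-4575`).  Pure set identities about the
open-connection events `openConn` of four vertices `a, b, c, y` of an arbitrary vertex type; no measure, no definitions, no named
facts, no sorries.  Used by `…E3FourPointSplitSunflower` (Sahi's `E₃` of the E3GRP class `γ` as a sunflower cubic) and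
`…E3FourPointClassesAllGraphs`.

For the split `ab|cy` write `D[ab|cy] = {a↮c} ∩ {a↮y} ∩ {b↮c} ∩ {b↮y}` ("the split is not crossed"; its complement is the E3GRP
link event `U[ab|cy]`), similarly `D[ac|by]`, `D[ay|bc]`; `Q₄` = all six pairs separated; `T` = "some three of `a,b,c,y` are
mutually joined", written `{ab}∩{ac} ∪ {ab}∩{ay} ∪ {ac}∩{ay} ∪ {bc}∩{by}` exactly as in
`Literature.Probability.Percolation.openConn_matching_inter₁₂`; `U₁ = {a↔b} ∪ {c↔y}`, `U₂ = {a↔c} ∪ {b↔y}`, `U₃ = {a↔y} ∪ {b↔c}`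
(the perfect matchings).
* `split_inter₁₂/₁₃/₂₃` — `D[split i] ∩ D[split j] = Q₄` (propositional): the three split-separations are a SUNFLOWER with core `Q₄`;
* `split_union_compl_eq_core` — `(D[ab|cy] ∪ D[ac|by] ∪ D[ay|bc])ᶜ = T` (all three splits crossed iff a three-block; uses
  transitivity of `↔`);  `split_core_eq_compl_union` — `Q₄ = (U₁ ∪ U₂ ∪ U₃)ᶜ`;
* `split_sdiff_eq_petal₁/₂/₃` — the petals coincide with the perfect-matching petals: `D[split k] ∖ Q₄ = U_k ∖ T`;
* `union_eq_compl_split`, `union₄_eq_compl_inter₄` — bookkeeping.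
So the decreasing sunflower `(Q₄; D[split k] ∖ Q₄)` and the increasing sunflower `(T; U_k ∖ T)` of `SahiSunflowerSeparation` live on
the SAME five cells `Q, x₁, x₂, x₃, R` of the four-point law.
-/

namespace Summit.CriticalPhenomena.PercolationContinuityZ3.Theorems

open Set
open Literature.Probability.Percolation

/-! ## The three 2|2-split separation events of four vertices form a sunflower with core `Q₄` -/

namespace FourPointSplit

variable {V : Type*}

/-- Transitivity of open connection, membership form. [folklore] -/
private theorem oc_trans {x y z : V} {ω : BondConfig V} (h₁ : ω ∈ openConn x y) (h₂ : ω ∈ openConn y z) :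
    ω ∈ openConn x z :=
  SimpleGraph.Reachable.trans h₁ h₂

/-- Symmetry of open connection, membership form. [folklore] -/
private theorem oc_symm {x y : V} {ω : BondConfig V} (h : ω ∈ openConn x y) : ω ∈ openConn y x :=
  SimpleGraph.Reachable.symm h

/-- **Sunflower, pair 1,2.**  `D[ab|cy] ∩ D[ac|by] = Q₄` (all six pairs of `a,b,c,y` separated). [folklore] -/
theorem split_inter₁₂ (a b c y : V) :
    (((openConn a c)ᶜ ∩ (openConn a y)ᶜ ∩ (openConn b c)ᶜ ∩ (openConn b y)ᶜ) ∩
        ((openConn a b)ᶜ ∩ (openConn a y)ᶜ ∩ (openConn b c)ᶜ ∩ (openConn c y)ᶜ) : Set (BondConfig V)) =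
      (openConn a b)ᶜ ∩ (openConn a c)ᶜ ∩ (openConn a y)ᶜ ∩ (openConn b c)ᶜ ∩ (openConn b y)ᶜ ∩ (openConn c y)ᶜ := by
  ext ω; simp only [mem_inter_iff, mem_compl_iff]; tauto

/-- **Sunflower, pair 1,3.**  `D[ab|cy] ∩ D[ay|bc] = Q₄`. [folklore] -/
theorem split_inter₁₃ (a b c y : V) :
    (((openConn a c)ᶜ ∩ (openConn a y)ᶜ ∩ (openConn b c)ᶜ ∩ (openConn b y)ᶜ) ∩
        ((openConn a b)ᶜ ∩ (openConn a c)ᶜ ∩ (openConn b y)ᶜ ∩ (openConn c y)ᶜ) : Set (BondConfig V)) =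
      (openConn a b)ᶜ ∩ (openConn a c)ᶜ ∩ (openConn a y)ᶜ ∩ (openConn b c)ᶜ ∩ (openConn b y)ᶜ ∩ (openConn c y)ᶜ := by
  ext ω; simp only [mem_inter_iff, mem_compl_iff]; tauto

/-- **Sunflower, pair 2,3.**  `D[ac|by] ∩ D[ay|bc] = Q₄`. [folklore] -/
theorem split_inter₂₃ (a b c y : V) :
    (((openConn a b)ᶜ ∩ (openConn a y)ᶜ ∩ (openConn b c)ᶜ ∩ (openConn c y)ᶜ) ∩
        ((openConn a b)ᶜ ∩ (openConn a c)ᶜ ∩ (openConn b y)ᶜ ∩ (openConn c y)ᶜ) : Set (BondConfig V)) =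
      (openConn a b)ᶜ ∩ (openConn a c)ᶜ ∩ (openConn a y)ᶜ ∩ (openConn b c)ᶜ ∩ (openConn b y)ᶜ ∩ (openConn c y)ᶜ := by
  ext ω; simp only [mem_inter_iff, mem_compl_iff]; tauto

/-- The split-linking event `U[ab|cy]` is the complement of `D[ab|cy]`. [folklore] -/
theorem union_eq_compl_split (a b c y : V) :
    (openConn a c ∪ openConn a y ∪ openConn b c ∪ openConn b y : Set (BondConfig V)) =
      ((openConn a c)ᶜ ∩ (openConn a y)ᶜ ∩ (openConn b c)ᶜ ∩ (openConn b y)ᶜ)ᶜ := by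
  ext ω; simp only [mem_union, mem_inter_iff, mem_compl_iff]; tauto

/-- `Q₄` is the complement of the union of the three perfect-matching link events `{ab ∨ cy}, {ac ∨ by}, {ay ∨ bc}`. [folklore] -/
theorem split_core_eq_compl_union (a b c y : V) :
    ((openConn a b)ᶜ ∩ (openConn a c)ᶜ ∩ (openConn a y)ᶜ ∩ (openConn b c)ᶜ ∩ (openConn b y)ᶜ ∩ (openConn c y)ᶜ :
        Set (BondConfig V)) =
      ((openConn a b ∪ openConn c y) ∪ (openConn a c ∪ openConn b y) ∪ (openConn a y ∪ openConn b c))ᶜ := by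
  ext ω; simp only [mem_union, mem_inter_iff, mem_compl_iff]; tauto

/-- **The outside of the split sunflower is the three-block event**: all three 2|2 splits of `{a,b,c,y}` are crossed iff some
three of the four vertices are mutually joined (written as in `Literature…openConn_matching_inter₁₂`). [folklore] -/
theorem split_union_compl_eq_core (a b c y : V) :
    ((((openConn a c)ᶜ ∩ (openConn a y)ᶜ ∩ (openConn b c)ᶜ ∩ (openConn b y)ᶜ) ∪
          ((openConn a b)ᶜ ∩ (openConn a y)ᶜ ∩ (openConn b c)ᶜ ∩ (openConn c y)ᶜ) ∪
          ((openConn a b)ᶜ ∩ (openConn a c)ᶜ ∩ (openConn b y)ᶜ ∩ (openConn c y)ᶜ))ᶜ : Set (BondConfig V)) =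
      openConn a b ∩ openConn a c ∪ openConn a b ∩ openConn a y ∪ openConn a c ∩ openConn a y ∪
        openConn b c ∩ openConn b y := by
  ext ω
  simp only [mem_compl_iff, mem_union, mem_inter_iff]
  constructor
  · intro h
    have n1 : ¬(((ω ∉ openConn a c ∧ ω ∉ openConn a y) ∧ ω ∉ openConn b c) ∧ ω ∉ openConn b y) :=
      fun x => h (Or.inl (Or.inl x))
    have n2 : ¬(((ω ∉ openConn a b ∧ ω ∉ openConn a y) ∧ ω ∉ openConn b c) ∧ ω ∉ openConn c y) :=
      fun x => h (Or.inl (Or.inr x))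
    have n3 : ¬(((ω ∉ openConn a b ∧ ω ∉ openConn a c) ∧ ω ∉ openConn b y) ∧ ω ∉ openConn c y) :=
      fun x => h (Or.inr x)
    by_cases hab : ω ∈ openConn a b
    · by_cases hac : ω ∈ openConn a c
      · exact Or.inl (Or.inl (Or.inl ⟨hab, hac⟩))
      · by_cases hay : ω ∈ openConn a y
        · exact Or.inl (Or.inl (Or.inr ⟨hab, hay⟩))
        · -- split `ab|cy` must be crossed by `bc` or `by`; either joins `a` to `c` or `y` through `b`
          have hbc : ω ∉ openConn b c := fun h' => hac (oc_trans hab h')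
          have hby : ω ∉ openConn b y := fun h' => hay (oc_trans hab h')
          exact (n1 ⟨⟨⟨hac, hay⟩, hbc⟩, hby⟩).elim
    · by_cases hac : ω ∈ openConn a c
      · by_cases hay : ω ∈ openConn a y
        · exact Or.inl (Or.inr ⟨hac, hay⟩)
        · -- split `ac|by` must be crossed by `bc` or `cy`
          have hbc : ω ∉ openConn b c := fun h' => hab (oc_trans hac (oc_symm h'))
          have hcy : ω ∉ openConn c y := fun h' => hay (oc_trans hac h')
          exact (n2 ⟨⟨⟨hab, hay⟩, hbc⟩, hcy⟩).elim
      · by_cases hay : ω ∈ openConn a y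
        · -- split `ay|bc` must be crossed by `by` or `cy`
          have hby : ω ∉ openConn b y := fun h' => hab (oc_trans hay (oc_symm h'))
          have hcy : ω ∉ openConn c y := fun h' => hac (oc_trans hay (oc_symm h'))
          exact (n3 ⟨⟨⟨hab, hac⟩, hby⟩, hcy⟩).elim
        · -- `a` isolated from `b, c, y`
          by_cases hbc : ω ∈ openConn b c
          · by_cases hby : ω ∈ openConn b y
            · exact Or.inr ⟨hbc, hby⟩
            · have hcy : ω ∉ openConn c y := fun h' => hby (oc_trans hbc h')
              exact (n3 ⟨⟨⟨hab, hac⟩, hby⟩, hcy⟩).elim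
          · by_cases hby : ω ∈ openConn b y
            · have hcy : ω ∉ openConn c y := fun h' => hbc (oc_trans hby (oc_symm h'))
              exact (n2 ⟨⟨⟨hab, hay⟩, hbc⟩, hcy⟩).elim
            · exact (n1 ⟨⟨⟨hac, hay⟩, hbc⟩, hby⟩).elim
  · rintro ((((⟨h1, h2⟩ | ⟨h1, h2⟩) | ⟨h1, h2⟩) | ⟨h1, h2⟩))
      ((⟨⟨⟨hac, hay⟩, hbc⟩, hby⟩ | ⟨⟨⟨hab, hay⟩, hbc⟩, hcy⟩) | ⟨⟨⟨hab, hac⟩, hby⟩, hcy⟩)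
    -- `a~b, a~c`
    · exact hac h2
    · exact hab h1
    · exact hab h1
    -- `a~b, a~y`
    · exact hay h2
    · exact hab h1
    · exact hab h1
    -- `a~c, a~y`
    · exact hac h1
    · exact hay h2
    · exact hac h1
    -- `b~c, b~y`
    · exact hbc h1
    · exact hbc h1
    · exact hby h2

/-- **Petal 1.**  `D[ab|cy] ∖ Q₄ = ({a↔b} ∪ {c↔y}) ∖ T` (`T` = some three of `a,b,c,y` mutually joined): outside `Q₄`, the split
`ab|cy` is uncrossed iff only pairs of the matching `{ab, cy}` are joined. [folklore] -/
theorem split_sdiff_eq_petal₁ (a b c y : V) :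
    (((openConn a c)ᶜ ∩ (openConn a y)ᶜ ∩ (openConn b c)ᶜ ∩ (openConn b y)ᶜ) \
        ((openConn a b)ᶜ ∩ (openConn a c)ᶜ ∩ (openConn a y)ᶜ ∩ (openConn b c)ᶜ ∩ (openConn b y)ᶜ ∩ (openConn c y)ᶜ) :
        Set (BondConfig V)) =
      (openConn a b ∪ openConn c y) \
        (openConn a b ∩ openConn a c ∪ openConn a b ∩ openConn a y ∪ openConn a c ∩ openConn a y ∪
          openConn b c ∩ openConn b y) := by
  ext ω
  simp only [mem_sdiff, mem_inter_iff, mem_compl_iff, mem_union]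
  constructor
  · rintro ⟨⟨⟨⟨hac, hay⟩, hbc⟩, hby⟩, hnQ⟩
    refine ⟨?_, ?_⟩
    · by_cases hab : ω ∈ openConn a b
      · exact Or.inl hab
      · by_cases hcy : ω ∈ openConn c y
        · exact Or.inr hcy
        · exact (hnQ ⟨⟨⟨⟨⟨hab, hac⟩, hay⟩, hbc⟩, hby⟩, hcy⟩).elim
    · rintro ((((⟨-, h⟩ | ⟨-, h⟩) | ⟨h, -⟩) | ⟨h, -⟩))
      exacts [hac h, hay h, hac h, hbc h]
  · rintro ⟨hU | hU, hnT⟩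
    · -- `a ~ b`
      refine ⟨⟨⟨⟨fun h => hnT (Or.inl (Or.inl (Or.inl ⟨hU, h⟩))), fun h => hnT (Or.inl (Or.inl (Or.inr ⟨hU, h⟩)))⟩,
        fun h => hnT (Or.inl (Or.inl (Or.inl ⟨hU, oc_trans hU h⟩)))⟩,
        fun h => hnT (Or.inl (Or.inl (Or.inr ⟨hU, oc_trans hU h⟩)))⟩, fun hQ => hQ.1.1.1.1.1 hU⟩
    · -- `c ~ y`
      refine ⟨⟨⟨⟨fun h => hnT (Or.inl (Or.inr ⟨h, oc_trans h hU⟩)),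
        fun h => hnT (Or.inl (Or.inr ⟨oc_trans h (oc_symm hU), h⟩))⟩,
        fun h => hnT (Or.inr ⟨h, oc_trans h hU⟩)⟩,
        fun h => hnT (Or.inr ⟨oc_trans h (oc_symm hU), h⟩)⟩, fun hQ => hQ.2 hU⟩

/-- **Petal 2.**  `D[ac|by] ∖ Q₄ = ({a↔c} ∪ {b↔y}) ∖ T`. [folklore] -/
theorem split_sdiff_eq_petal₂ (a b c y : V) :
    (((openConn a b)ᶜ ∩ (openConn a y)ᶜ ∩ (openConn b c)ᶜ ∩ (openConn c y)ᶜ) \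
        ((openConn a b)ᶜ ∩ (openConn a c)ᶜ ∩ (openConn a y)ᶜ ∩ (openConn b c)ᶜ ∩ (openConn b y)ᶜ ∩ (openConn c y)ᶜ) :
        Set (BondConfig V)) =
      (openConn a c ∪ openConn b y) \
        (openConn a b ∩ openConn a c ∪ openConn a b ∩ openConn a y ∪ openConn a c ∩ openConn a y ∪
          openConn b c ∩ openConn b y) := by
  ext ω
  simp only [mem_sdiff, mem_inter_iff, mem_compl_iff, mem_union]
  constructor
  · rintro ⟨⟨⟨⟨hab, hay⟩, hbc⟩, hcy⟩, hnQ⟩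
    refine ⟨?_, ?_⟩
    · by_cases hac : ω ∈ openConn a c
      · exact Or.inl hac
      · by_cases hby : ω ∈ openConn b y
        · exact Or.inr hby
        · exact (hnQ ⟨⟨⟨⟨⟨hab, hac⟩, hay⟩, hbc⟩, hby⟩, hcy⟩).elim
    · rintro ((((⟨h, -⟩ | ⟨h, -⟩) | ⟨-, h⟩) | ⟨h, -⟩))
      exacts [hab h, hab h, hay h, hbc h]
  · rintro ⟨hU | hU, hnT⟩
    · -- `a ~ c`
      refine ⟨⟨⟨⟨fun h => hnT (Or.inl (Or.inl (Or.inl ⟨h, hU⟩))), fun h => hnT (Or.inl (Or.inr ⟨hU, h⟩))⟩,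
        fun h => hnT (Or.inl (Or.inl (Or.inl ⟨oc_trans hU (oc_symm h), hU⟩)))⟩,
        fun h => hnT (Or.inl (Or.inr ⟨hU, oc_trans hU h⟩))⟩, fun hQ => hQ.1.1.1.1.2 hU⟩
    · -- `b ~ y`
      refine ⟨⟨⟨⟨fun h => hnT (Or.inl (Or.inl (Or.inr ⟨h, oc_trans h hU⟩))),
        fun h => hnT (Or.inl (Or.inl (Or.inr ⟨oc_trans h (oc_symm hU), h⟩)))⟩,
        fun h => hnT (Or.inr ⟨h, hU⟩)⟩,
        fun h => hnT (Or.inr ⟨oc_trans hU (oc_symm h), hU⟩)⟩, fun hQ => hQ.1.2 hU⟩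

/-- **Petal 3.**  `D[ay|bc] ∖ Q₄ = ({a↔y} ∪ {b↔c}) ∖ T`. [folklore] -/
theorem split_sdiff_eq_petal₃ (a b c y : V) :
    (((openConn a b)ᶜ ∩ (openConn a c)ᶜ ∩ (openConn b y)ᶜ ∩ (openConn c y)ᶜ) \
        ((openConn a b)ᶜ ∩ (openConn a c)ᶜ ∩ (openConn a y)ᶜ ∩ (openConn b c)ᶜ ∩ (openConn b y)ᶜ ∩ (openConn c y)ᶜ) :
        Set (BondConfig V)) =
      (openConn a y ∪ openConn b c) \
        (openConn a b ∩ openConn a c ∪ openConn a b ∩ openConn a y ∪ openConn a c ∩ openConn a y ∪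
          openConn b c ∩ openConn b y) := by
  ext ω
  simp only [mem_sdiff, mem_inter_iff, mem_compl_iff, mem_union]
  constructor
  · rintro ⟨⟨⟨⟨hab, hac⟩, hby⟩, hcy⟩, hnQ⟩
    refine ⟨?_, ?_⟩
    · by_cases hay : ω ∈ openConn a y
      · exact Or.inl hay
      · by_cases hbc : ω ∈ openConn b c
        · exact Or.inr hbc
        · exact (hnQ ⟨⟨⟨⟨⟨hab, hac⟩, hay⟩, hbc⟩, hby⟩, hcy⟩).elim
    · rintro ((((⟨h, -⟩ | ⟨h, -⟩) | ⟨h, -⟩) | ⟨-, h⟩))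
      exacts [hab h, hab h, hac h, hby h]
  · rintro ⟨hU | hU, hnT⟩
    · -- `a ~ y`
      refine ⟨⟨⟨⟨fun h => hnT (Or.inl (Or.inl (Or.inr ⟨h, hU⟩))), fun h => hnT (Or.inl (Or.inr ⟨h, hU⟩))⟩,
        fun h => hnT (Or.inl (Or.inl (Or.inr ⟨oc_trans hU (oc_symm h), hU⟩)))⟩,
        fun h => hnT (Or.inl (Or.inr ⟨oc_trans hU (oc_symm h), hU⟩))⟩, fun hQ => hQ.1.1.1.2 hU⟩
    · -- `b ~ c`
      refine ⟨⟨⟨⟨fun h => hnT (Or.inl (Or.inl (Or.inl ⟨h, oc_trans h hU⟩))),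
        fun h => hnT (Or.inl (Or.inl (Or.inl ⟨oc_trans h (oc_symm hU), h⟩)))⟩,
        fun h => hnT (Or.inr ⟨hU, h⟩)⟩,
        fun h => hnT (Or.inr ⟨hU, oc_trans hU h⟩)⟩, fun hQ => hQ.1.1.2 hU⟩

/-- Four sets: `A ∪ B ∪ C ∪ D = (Aᶜ ∩ Bᶜ ∩ Cᶜ ∩ Dᶜ)ᶜ`. [folklore] -/
theorem union₄_eq_compl_inter₄ {X : Type*} (A B C D : Set X) : A ∪ B ∪ C ∪ D = (Aᶜ ∩ Bᶜ ∩ Cᶜ ∩ Dᶜ)ᶜ := by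
  ext ω; simp only [mem_union, mem_inter_iff, mem_compl_iff]; tauto

end FourPointSplit

end Summit.CriticalPhenomena.PercolationContinuityZ3.Theorems
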